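import Summits.QuantumAdvantage.QuantumAdvantage.Theorems.LinnikCubicClassGroupsPureCubicClassGroupFBQPStubClassTableSemCircle
import Literature.NumberTheory.CubicFields.PeriodicChainCells
import Literature.NumberTheory.CubicFields.VoronoiCylinderStep

/-!
# Crux `LinnikCubicClassGroups.PureCubicClassGroupFBQP` (stmt-QuantumAdvantage-11544) — stub `stub_classTableSem`, part MATCH

Line `arakelov-giant-step-cycle`, stub `stub_classTableSem` (S5b-P5b): MATCHING ONE TABLE VALUE WITH THE IDEAL CELL. With the
walk stopped just left of the target `t⋆` at a reduced label of computed position within `εpos` of its true `2^prec`-scaled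
distance (the walk package), and the target coordinate `u = t⋆/2^prec − log σ₁ α` (in the coordinates of the fixed circle of
the class, `A_E = α · A_g`) farther than `η ≥ (εpos + 2)/2^prec` from every breakpoint of the cells:

* `match_cell` — the pure real-variable lemma: the stopping index IS the cell index of `u` and the integer cell offset
  `⌊(t⋆ − pos)/2^(prec − npp)⌋` IS the sub-cell offset `⌊(u − G(idx u)) 2^npp⌋`;
* `table_value_eq_cell` — hence the table value `(code, offset)` equals the ideal cell value `(Lab (idx u), ⌊(u − G(idx u)) 2^npp⌋₊)`
  (the two codes are canonical codes of the same reduced ideal `(α θ(k₀))⁻¹ (α A_g) = θ(k₀)⁻¹ A_g`).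

Used by `table_value_eq_shiftCell` (file `…StubClassTableSemCore`) and the final assembly of `stub_classTableSem`.

Maintenance (full-build repair 2026-08-17): `match_cell` hit the 200000-heartbeat ceiling in the full build of
2026-08-16T23:32Z (`nlinarith` searches); its five `nlinarith` calls are replaced by `linarith` with the one product
each actually needs (`mul_nonneg`, `mul_pos hη0 h2n`) — same statement, now < 75000 heartbeats.
-/

set_option linter.dupNamespace false

namespace Summit.QuantumAdvantage.QuantumAdvantage.Theorems.LinnikCubicClassGroups

open scoped NumberField nonZeroDivisors
open NumberField
open Literature.NumberTheory.CubicFields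
open Literature.NumberTheory.CubicFields.PureCubicCodes (Canon Mem)

/-- **Matching the stopping cell, real-variable form.** -/
theorem match_cell {G : ℤ → ℝ} (hG : StrictMono G) {idx : ℝ → ℤ} (hidx : ∀ x, G (idx x) ≤ x ∧ x < G (idx x + 1))
    {prec npp : ℕ} (hnpp : npp ≤ prec) {tstarc pos l : ℤ} {logα εpos η : ℝ} (hε0 : 0 ≤ εpos) (k₀ : ℤ)
    (hpos : |(pos : ℝ) - 2 ^ prec * (logα + G k₀)| ≤ εpos) (hρ : 0 ≤ tstarc - pos)
    (hlt : ((tstarc - pos : ℤ) : ℝ) < l) (hl : |(l : ℝ) - 2 ^ prec * (G (k₀ + 1) - G k₀)| ≤ 1)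
    (hη : (εpos + 2) / 2 ^ prec ≤ η)
    (hfar : ∀ (k : ℤ) (m : ℕ), (m : ℝ) / 2 ^ npp < G (k + 1) - G k →
      η < |((tstarc : ℝ) / 2 ^ prec - logα) - (G k + m / 2 ^ npp)|) :
    idx ((tstarc : ℝ) / 2 ^ prec - logα) = k₀ ∧
      ((tstarc - pos).toNat / 2 ^ (prec - npp) : ℕ) =
        ⌊(((tstarc : ℝ) / 2 ^ prec - logα) - G (idx ((tstarc : ℝ) / 2 ^ prec - logα))) * 2 ^ npp⌋₊ := by
  set u : ℝ := (tstarc : ℝ) / 2 ^ prec - logα with hu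
  have h2p : (0 : ℝ) < 2 ^ prec := by positivity
  have h2n : (0 : ℝ) < 2 ^ npp := by positivity
  have hη0 : 0 < η := lt_of_lt_of_le (by positivity) hη
  have hgap : 0 < G (k₀ + 1) - G k₀ := sub_pos.mpr (hG (lt_add_one k₀))
  rw [abs_le] at hpos hl
  have hut : u * 2 ^ prec = tstarc - 2 ^ prec * logα := by rw [hu]; field_simp
  have hρ' : (pos : ℝ) ≤ tstarc := by exact_mod_cast (show pos ≤ tstarc by linarith)
  push_cast at hlt
  -- (a) the index
  have hlow : G k₀ - εpos / 2 ^ prec ≤ u := by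
    have h2 : -εpos ≤ (u - G k₀) * 2 ^ prec := by linarith [hpos.1]
    have h3 := (div_le_iff₀ h2p).mpr h2
    rw [neg_div] at h3
    linarith
  have hupp : u < G (k₀ + 1) + (εpos + 1) / 2 ^ prec := by
    have h2 : (u - G (k₀ + 1)) * 2 ^ prec < εpos + 1 := by linarith [hpos.2, hl.2]
    have h3 := (lt_div_iff₀ h2p).mpr h2
    linarith
  have hηε : εpos / 2 ^ prec < η := by
    have : εpos / 2 ^ prec < (εpos + 2) / 2 ^ prec := by gcongr; linarith
    exact this.trans_le hη
  have hηε1 : (εpos + 1) / 2 ^ prec < η := by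
    have : (εpos + 1) / 2 ^ prec < (εpos + 2) / 2 ^ prec := by gcongr; linarith
    exact this.trans_le hη
  have h0far := hfar k₀ 0 (by rw [Nat.cast_zero, zero_div]; exact hgap)
  have h1far := hfar (k₀ + 1) 0 (by rw [Nat.cast_zero, zero_div]; exact sub_pos.mpr (hG (lt_add_one _)))
  simp only [Nat.cast_zero, zero_div, add_zero] at h0far h1far
  rw [lt_abs] at h0far h1far
  have hk1 : G k₀ + η < u := by
    rcases h0far with h | h
    · linarith
    · exfalso; linarith
  have hk2 : u < G (k₀ + 1) - η := by
    rcases h1far with h | h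
    · exfalso; linarith
    · linarith
  have hidxu : idx u = k₀ := chain_index_eq hG hidx (by linarith) (by linarith)
  refine ⟨hidxu, ?_⟩
  rw [hidxu]
  -- (b) the offset
  have htn : (((tstarc - pos).toNat : ℕ) : ℝ) = (tstarc : ℝ) - pos := by
    have h : (((tstarc - pos).toNat : ℕ) : ℤ) = tstarc - pos := Int.toNat_of_nonneg hρ
    have h' := congrArg (fun z : ℤ => (z : ℝ)) h
    push_cast at h'; exact h'
  have hdiv : (((tstarc - pos).toNat / 2 ^ (prec - npp) : ℕ)) = ⌊(((tstarc - pos).toNat : ℕ) : ℝ) / ((2 ^ (prec - npp) : ℕ) : ℝ)⌋₊ :=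
    (Nat.floor_div_eq_div _ _).symm
  rw [hdiv, htn]
  set x : ℝ := (u - G k₀) * 2 ^ npp with hx
  set δ : ℝ := (2 ^ prec * (logα + G k₀) - pos) * 2 ^ npp / 2 ^ prec with hδ
  have hpe : (2 : ℝ) ^ prec = 2 ^ (prec - npp) * 2 ^ npp := by rw [← pow_add]; congr 1; omega
  have hxδ : ((tstarc : ℝ) - pos) / ((2 ^ (prec - npp) : ℕ) : ℝ) = x + δ := by
    rw [hx, hδ, hu]
    push_cast
    have h2pn : (0 : ℝ) < 2 ^ (prec - npp) := by positivity
    field_simp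
    rw [hpe]; ring
  rw [hxδ]
  have hx0 : 0 ≤ x := by rw [hx]; exact mul_nonneg (by linarith) h2n.le
  have hδb : |δ| ≤ εpos * 2 ^ npp / 2 ^ prec := by
    rw [hδ, abs_div, abs_of_pos h2p, div_le_div_iff_of_pos_right h2p, abs_mul, abs_of_pos h2n]
    apply mul_le_mul_of_nonneg_right _ h2n.le
    rw [abs_le]; constructor <;> linarith
  have hηn : εpos * 2 ^ npp / 2 ^ prec < η * 2 ^ npp := by
    have h := mul_lt_mul_of_pos_right hηε h2n
    calc εpos * 2 ^ npp / 2 ^ prec = εpos / 2 ^ prec * 2 ^ npp := by ring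
      _ < η * 2 ^ npp := h
  rw [abs_le] at hδb
  set m₀ : ℕ := ⌊x⌋₊ with hm₀
  have hm₀le : (m₀ : ℝ) ≤ x := Nat.floor_le hx0
  have hm₀lt : x < m₀ + 1 := Nat.lt_floor_add_one x
  have em : ((m₀ : ℝ) / 2 ^ npp) * 2 ^ npp = m₀ := div_mul_cancel₀ _ h2n.ne'
  have em1 : (((m₀ + 1 : ℕ) : ℝ) / 2 ^ npp) * 2 ^ npp = ((m₀ + 1 : ℕ) : ℝ) := div_mul_cancel₀ _ h2n.ne'
  have hxgap : x < (G (k₀ + 1) - G k₀ - η) * 2 ^ npp := by rw [hx]; exact mul_lt_mul_of_pos_right (by linarith) h2n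
  -- lower bound `m₀ ≤ x + δ`
  have hlb : (m₀ : ℝ) ≤ x + δ := by
    by_cases hm : (m₀ : ℝ) / 2 ^ npp < G (k₀ + 1) - G k₀
    · have h := hfar k₀ m₀ hm
      rw [lt_abs] at h
      rcases h with h | h
      · have h' := mul_lt_mul_of_pos_right h h2n
        linarith [em, h']
      · exfalso
        have h' := mul_lt_mul_of_pos_right h h2n
        linarith [em, h']
    · exfalso
      push Not at hm
      rw [le_div_iff₀ h2n] at hm
      linarith [mul_pos hη0 h2n]
  -- upper bound `x + δ < m₀ + 1`
  have hub : x + δ < m₀ + 1 := by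
    by_cases hm : ((m₀ + 1 : ℕ) : ℝ) / 2 ^ npp < G (k₀ + 1) - G k₀
    · have h := hfar k₀ (m₀ + 1) hm
      rw [lt_abs] at h
      rcases h with h | h
      · exfalso
        have h' := mul_lt_mul_of_pos_right h h2n
        push_cast at h' em1
        linarith [em1, h']
      · have h' := mul_lt_mul_of_pos_right h h2n
        push_cast at h' em1
        linarith [em1, h']
    · push Not at hm
      rw [le_div_iff₀ h2n] at hm
      push_cast at hm
      linarith [hδb.2, hηn, hxgap, hm]
  rw [Nat.floor_eq_iff (le_trans (Nat.cast_nonneg _) hlb)]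
  exact ⟨hlb, hub⟩


/-- **P5b helper `classTableSem_match_cell`** (registered): the stopping cell of the walk is the cell of the target. -/
theorem classTableSem_match_cell : ∀ (G : ℤ → ℝ), StrictMono G → ∀ (idx : ℝ → ℤ), (∀ x, G (idx x) ≤ x ∧ x < G (idx x + 1)) → ∀ (prec npp : ℕ), npp ≤ prec → ∀ (tstarc pos l : ℤ) (logα εpos η : ℝ), 0 ≤ εpos → ∀ (k₀ : ℤ), |(pos : ℝ) - 2 ^ prec * (logα + G k₀)| ≤ εpos → 0 ≤ tstarc - pos → ((tstarc - pos : ℤ) : ℝ) < l → |(l : ℝ) - 2 ^ prec * (G (k₀ + 1) - G k₀)| ≤ 1 → (εpos + 2) / 2 ^ prec ≤ η → (∀ (k : ℤ) (m : ℕ), (m : ℝ) / 2 ^ npp < G (k + 1) - G k → η < |((tstarc : ℝ) / 2 ^ prec - logα) - (G k + m / 2 ^ npp)|) → idx ((tstarc : ℝ) / 2 ^ prec - logα) = k₀ ∧ ((tstarc - pos).toNat / 2 ^ (prec - npp) : ℕ) = ⌊(((tstarc : ℝ) / 2 ^ prec - logα) - G (idx ((tstarc : ℝ) / 2 ^ prec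 - logα))) * 2 ^ npp⌋₊ :=
  fun _ hG _ hidx _ _ hnpp _ _ _ _ _ _ hε0 k₀ hpos hρ hlt hl hη hfar =>
    match_cell hG hidx hnpp hε0 k₀ hpos hρ hlt hl hη hfar

/-- **P5b helper under its REGISTERED stub name** `classTableSem_semMatch_cell` (the stub register of
stmt-QuantumAdvantage-11544 spells the helper this way; same statement as `classTableSem_match_cell`, added at the
full-build repair of 2026-08-17 so that this `--supports` file matches a registered stub by name and signature). -/
theorem classTableSem_semMatch_cell : ∀ (G : ℤ → ℝ), StrictMono G → ∀ (idx : ℝ → ℤ), (∀ x, G (idx x) ≤ x ∧ x < G (idx x + 1)) → ∀ (prec npp : ℕ), npp ≤ prec → ∀ (tstarc pos l : ℤ) (logα εpos η : ℝ), 0 ≤ εpos → ∀ (k₀ : ℤ), |(pos : ℝ) - 2 ^ prec * (logα + G k₀)| ≤ εpos → 0 ≤ tstarc - pos → ((tstarc - pos : ℤ) : ℝ) < l → |(l : ℝ) - 2 ^ prec * (G (k₀ + 1) - G k₀)| ≤ 1 → (εpos + 2) / 2 ^ prec ≤ η → (∀ (k : ℤ) (m : ℕ), (m : ℝ) / 2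 ^ npp < G (k + 1) - G k → η < |((tstarc : ℝ) / 2 ^ prec - logα) - (G k + m / 2 ^ npp)|) → idx ((tstarc : ℝ) / 2 ^ prec - logα) = k₀ ∧ ((tstarc - pos).toNat / 2 ^ (prec - npp) : ℕ) = ⌊(((tstarc : ℝ) / 2 ^ prec - logα) - G (idx ((tstarc : ℝ) / 2 ^ prec - logα))) * 2 ^ npp⌋₊ :=
  classTableSem_match_cell

section Table

variable {K : Type} [Field K] [NumberField K] {a b : ℕ} {θ : K} {σ₁ : K →+* ℝ} {σ₂ : K →+* ℂ}
variable (hdeg : Module.finrank ℚ K = 3) (hσ₂ : ∃ z : K, starRingEnd ℂ (σ₂ z) ≠ σ₂ z)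
  (ε : (𝓞 K)ˣ) (hε : 1 < σ₁ (algebraMap (𝓞 K) K ε))
  (hab : Squarefree (a * b)) (hab1 : a * b ≠ 1) (hθ : θ ^ 3 = ((a * b ^ 2 : ℕ) : K))

include hdeg hσ₂ hε hab hab1 hθ in
/-- **The table value equals the ideal cell value.** -/
theorem table_value_eq_cell {Ag : FractionalIdeal (𝓞 K)⁰ K} {x₀ : K} (hx₀ : x₀ ∈ posRelMinima σ₁ σ₂ Ag)
    {Lab : ℤ → ℕ × List ℤ} (hLab : ∀ i, Canon (Lab i) ∧ ∀ φ : K, Mem θ b (Lab i) φ ↔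
      φ ∈ FractionalIdeal.spanSingleton (𝓞 K)⁰ (voronoiChain σ₁ σ₂ Ag x₀ i)⁻¹ * Ag)
    {idx : ℝ → ℤ} (hidx : ∀ x, Real.log (σ₁ (voronoiChain σ₁ σ₂ Ag x₀ (idx x))) ≤ x ∧
      x < Real.log (σ₁ (voronoiChain σ₁ σ₂ Ag x₀ (idx x + 1))))
    {α : K} (hα : 0 < σ₁ α) {β : K} (hβ : β ∈ posRelMinima σ₁ σ₂ (FractionalIdeal.spanSingleton (𝓞 K)⁰ α * Ag))
    {c₁ : ℕ × List ℤ} (hc₁ : Canon c₁)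
    (hm₁ : ∀ φ : K, Mem θ b c₁ φ ↔ φ ∈ FractionalIdeal.spanSingleton (𝓞 K)⁰ β⁻¹ * (FractionalIdeal.spanSingleton (𝓞 K)⁰ α * Ag))
    {prec npp : ℕ} (hnpp : npp ≤ prec) {tstarc pos l : ℤ} {εpos η : ℝ} (hε0 : 0 ≤ εpos)
    (hpos : |(pos : ℝ) - 2 ^ prec * Real.log (σ₁ β)| ≤ εpos) (hρ : 0 ≤ tstarc - pos)
    (hlt : ((tstarc - pos : ℤ) : ℝ) < l)
    (hl : |(l : ℝ) - 2 ^ prec * (Real.log (σ₁ (voronoiSucc σ₁ σ₂ (FractionalIdeal.spanSingleton (𝓞 K)⁰ α * Ag) β)) -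
      Real.log (σ₁ β))| ≤ 1)
    (hη : (εpos + 2) / 2 ^ prec ≤ η)
    (hfar : ∀ (k : ℤ) (m : ℕ), (m : ℝ) / 2 ^ npp < Real.log (σ₁ (voronoiChain σ₁ σ₂ Ag x₀ (k + 1))) -
        Real.log (σ₁ (voronoiChain σ₁ σ₂ Ag x₀ k)) →
      η < |((tstarc : ℝ) / 2 ^ prec - Real.log (σ₁ α)) -
        (Real.log (σ₁ (voronoiChain σ₁ σ₂ Ag x₀ k)) + m / 2 ^ npp)|) :
    (c₁, ((tstarc - pos).toNat / 2 ^ (prec - npp) : ℕ)) =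
      (Lab (idx ((tstarc : ℝ) / 2 ^ prec - Real.log (σ₁ α))),
        ⌊(((tstarc : ℝ) / 2 ^ prec - Real.log (σ₁ α)) -
          Real.log (σ₁ (voronoiChain σ₁ σ₂ Ag x₀ (idx ((tstarc : ℝ) / 2 ^ prec - Real.log (σ₁ α)))))) * 2 ^ npp⌋₊) := by
  have hα0 : α ≠ 0 := (map_ne_zero σ₁).mp hα.ne'
  have hmem := fun i => voronoiChain_mem hdeg hσ₂ ε hε hx₀ i
  have hpos' : ∀ i, 0 < σ₁ (voronoiChain σ₁ σ₂ Ag x₀ i) := fun i => (hmem i).2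
  set G : ℤ → ℝ := fun i => Real.log (σ₁ (voronoiChain σ₁ σ₂ Ag x₀ i)) with hG
  have hGm : StrictMono G := fun i j hij => Real.log_lt_log (hpos' i) (voronoiChain_strictMono hdeg hσ₂ ε hε hx₀ hij)
  -- `β = α θ(k₀)`
  obtain ⟨k₀, hk₀⟩ := exists_voronoiChain_eq hdeg hσ₂ ε hε hx₀ (inv_mul_mem_posRelMinima hα hβ)
  have hβeq : β = α * voronoiChain σ₁ σ₂ Ag x₀ k₀ := by rw [hk₀, ← mul_assoc, mul_inv_cancel₀ hα0, one_mul]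
  have hlogβ : Real.log (σ₁ β) = Real.log (σ₁ α) + G k₀ := by
    rw [hβeq, map_mul, Real.log_mul hα.ne' (hpos' k₀).ne']
  have hsucc : voronoiSucc σ₁ σ₂ (FractionalIdeal.spanSingleton (𝓞 K)⁰ α * Ag) β = α * voronoiChain σ₁ σ₂ Ag x₀ (k₀ + 1) := by
    rw [hβeq, voronoiSucc_mul hdeg hσ₂ ε hε hα (hmem k₀), voronoiChain_succ hdeg hσ₂ ε hε hx₀]
  have hlogsucc : Real.log (σ₁ (voronoiSucc σ₁ σ₂ (FractionalIdeal.spanSingleton (𝓞 K)⁰ α * Ag) β)) - Real.log (σ₁ β) =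
      G (k₀ + 1) - G k₀ := by
    rw [hsucc, hlogβ, map_mul, Real.log_mul hα.ne' (hpos' _).ne']; ring
  rw [hlogβ] at hpos
  rw [hlogsucc] at hl
  obtain ⟨hidxu, hoff⟩ := match_cell hGm hidx hnpp hε0 k₀ hpos hρ hlt hl hη hfar
  rw [Prod.mk.injEq]
  refine ⟨?_, hoff⟩
  -- the two canonical codes of `θ(k₀)⁻¹ A_g`
  rw [hidxu]
  have hind := fun c₀ c₁ c₂ h => Literature.NumberTheory.NumberFields.PureCubic.coords_eq_zero (K := K) hdeg hab hab1 hθ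
    (c₀ := c₀) (c₁ := c₁) (c₂ := c₂) h
  apply PureCubicCodes.canon_unique θ b hind _ _ hc₁ (hLab k₀).1
  intro φ
  rw [hm₁ φ, (hLab k₀).2 φ, hβeq, mul_inv, ← FractionalIdeal.spanSingleton_mul_spanSingleton]
  have e : FractionalIdeal.spanSingleton (𝓞 K)⁰ α⁻¹ * FractionalIdeal.spanSingleton (𝓞 K)⁰ (voronoiChain σ₁ σ₂ Ag x₀ k₀)⁻¹ *
      (FractionalIdeal.spanSingleton (𝓞 K)⁰ α * Ag) =
      FractionalIdeal.spanSingleton (𝓞 K)⁰ (voronoiChain σ₁ σ₂ Ag x₀ k₀)⁻¹ * Ag := by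
    rw [mul_comm (FractionalIdeal.spanSingleton (𝓞 K)⁰ α⁻¹), mul_assoc, ← mul_assoc (FractionalIdeal.spanSingleton (𝓞 K)⁰ α⁻¹),
      FractionalIdeal.spanSingleton_mul_spanSingleton, inv_mul_cancel₀ hα0, FractionalIdeal.spanSingleton_one, one_mul]
  rw [e]

end Table

end Summit.QuantumAdvantage.QuantumAdvantage.Theorems.LinnikCubicClassGroups
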